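import Summits.AtomisticToContinuum.BoseEinsteinCondensation.Theorems.BECInsertionCorrectorCorrectorClosureZeroModeFSumMoment
import HarnessLib

/-!
# The zero-mode f-sum bound `m₁(N̂₀) = 𝓔_{|Φ|}(g_Φ, g_Φ) ≤ A ρ_L N` (registered stub `stub_zeroModeFSum`
# of line `volume-homotopy-sum-rule-domination`, crux `BECInsertionCorrector.CorrectorClosure`,
# item stmt-AtomisticToContinuum-12058)

Supports (does not close) stmt-AtomisticToContinuum-12058: lands the registered stub S3a
`stub_zeroModeFSum` of the skeleton `Cruxes/CorrectorClosure/Lines/volume_homotopy_sum_rule_domination`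
(v3), the f-sum half of the zero-mode moment module `{S3a, S3b, S3g}` for `12616′`.

**Statement.** For a smooth-class pair potential `v` there are `A ≥ 0`, `ρ₀ > 0` such that for all
large `n`, every box `L ≥ sideLength ρ₀ (n+2)` and every real non-negative nowhere-vanishing minimiser
`Φ` of `n + 2` bosons: the zero-mode counting ratio `g_Φ = (N̂₀Φ)/Φ`,
`(N̂₀Φ)(X) = ∑ⱼ L⁻³∫_{cell} Φ(X; xⱼ ↦ y) dy`, is a periodic test function and
`𝓔_{|Φ|}(g_Φ, g_Φ) ≤ A · ((n+2)/L³) · (n+2)`. We prove it with `A = 2‖v‖₁`, `‖v‖₁ = ∫_{ℝ³} v(|x|)dx`,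
`ρ₀ = 1` and for EVERY `n` (the bound is `𝓔 ≤ 2‖v‖₁ N(N−1)/L³`, no density condition).

**Proof** (`F = |Φ|`, `uⱼ = PⱼF`, `u = N̂₀F = ∑ⱼuⱼ`, `g = u/F`, `E = E₀(N, L)`, `V = ∑_{k<l} v^per_{kl}`).
1. Ground-state representation (`zf_dirichlet_eq_firstMoment`): the weak Euler–Lagrange equation of `Φ`
   for all periodic `C¹` tests (`tilt_el_all`) on `ζ = g²` and the pointwise Jacobi identity
   `|∇(gF)|² = ∇F·∇(g²F) + |∇g|²F²` give `𝓔_F(g,g) = ∫|∇u|² + ∫Vu² − E∫u² = ⟨u,(H−E)u⟩ =: m₁`.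
2. Bose symmetry (`zf_firstMoment_symm`): `m₁ = ∑ⱼ ⟨uⱼ,(H−E)u⟩ = N⟨u₀,(H−E)u⟩`.
3. `[T, P₀] = 0`, `P₀ = P₀*` and the E–L equation on `ζ = (P₀u)/F` (`zf_firstMoment_slot_zero`):
   `⟨u₀,(H−E)u⟩ = ⟨F, (H−E)P₀u⟩ + ⟨F,[P₀,V]u⟩ = ⟨u₀, Vu⟩ − ⟨VF, P₀u⟩`.
4. `[P₀, v_{kl}] = 0` for `k, l ≥ 1` (`zf_pot_reduction`): only the `N − 1` pairs `(0, l)` survive, all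
   equal to the pair `(0,1)` by relabelling: `⟨u₀,Vu⟩ − ⟨VF,P₀u⟩ = (N−1)(⟨u₀,v₀₁u⟩ − ⟨v₀₁F,P₀u⟩)`.
5. `[P_m, v₀₁] = [P_m, P₀] = 0` for `m ≥ 2` (`zf_pair_bound`): in `u = ∑_m u_m` only `m ∈ {0,1}`
   survive, `⟨u₀,v₀₁u₀⟩ − ⟨v₀₁F,u₀⟩ + ⟨u₀,v₀₁u₁⟩ − ⟨v₀₁F,P₀u₁⟩ ≤ ⟨u₀,v₀₁u₀⟩ + ⟨u₀,v₀₁u₁⟩ ≤ 2⟨u₀,v₀₁u₀⟩`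
   (all functions are `≥ 0`; AM–GM and the `(0 1)` relabelling), and
   `⟨u₀,v₀₁u₀⟩ = ‖v‖₁L⁻³‖u₀‖² ≤ ‖v‖₁L⁻³` (`P₀v₀₁P₀ = L⁻³‖v‖₁P₀`, `‖P₀‖ ≤ 1`, `‖F‖ = 1`).
Altogether `m₁ ≤ 2‖v‖₁ N(N−1)/L³` — the double commutator `½⟨[N̂₀,[V,N̂₀]]⟩` of the f-sum rule.
Steps 1–4 are `…ZeroModeFSumMoment.lean`, the slot-`0` calculus `…ZeroModeFSumAverage.lean` and the
commutator identities `…ZeroModeFSumCommutator.lean`; this file proves step 5 (`zf_pair_bound`), the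
bound at fixed `(n, L)` (`zf_dirichlet_le`) and the stub.

## References

* [Stringari1995] S. Stringari, *Sum rules and Bose–Einstein condensation*, §2.3 (19)–(23).
* [PitaevskiiStringari1991] L. Pitaevskii, S. Stringari, *Uncertainty principle, quantum fluctuations
  and broken symmetries*, J. Low Temp. Phys. 85 (1991), (9).
* [ReedSimonIV1978] M. Reed, B. Simon, *Methods of Modern Mathematical Physics IV*, §XIII.1.
-/

noncomputable section

namespace Summit.AtomisticToContinuum.BoseEinsteinCondensation.Theorems.CorrectorClosure.VolumeHomotopySumRuleDomination

open MeasureTheory Filter Matrix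
open scoped ENNReal NNReal BigOperators
open Literature.MathematicalPhysics.QuantumManyBody.BoseGas
open Summit.AtomisticToContinuum.BoseEinsteinCondensation.Theorems.CorrectorClosure.GeometricMeanCorrector
  (mixedLaw_tail_vecCons mixedLaw_continuous_tail)
open Summit.AtomisticToContinuum.BoseEinsteinCondensation.Theorems.CorrectorClosure.HealingScaleKacInsertion.ResponseDictionary
  (setIntegral_cellN_comp_perm)
open Summit.AtomisticToContinuum.BoseEinsteinCondensation.Theorems.PositiveMinimiser
  (contDiff_toReal_periodizedPotential contDiff_toReal_periodicInteraction)

variable {n : ℕ} {L : ℝ}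

/-! ### Step 5: `[P_m, v₀₁] = [P_m, P₀] = 0` for `m ≥ 2`, positivity, `P₀v₀₁P₀ = L⁻³‖v‖₁P₀` -/

/-- **The pair `(0,1)` bound.** For `F ≥ 0` symmetric periodic test, `uⱼ = PⱼF`, `u = ∑uⱼ`, `W = P₀u`:
`∫v₀₁u₀u − ∫v₀₁F(W∘tail) ≤ 2‖v‖₁L⁻³∫F²`. In the slot expansion `u = ∑_m u_m`, `W = ∑_m P₀u_m` the
slots `m ≥ 2` cancel exactly (relabel by `(0 m)`: `⟨u₀,v₀₁u_m⟩ = ⟨u_m, v_{m1}u₀⟩` and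
`⟨v₀₁F,P₀u_m⟩ = ⟨v_{m1}F, P₀u_m⟩` by `P_mP₀ = P₀P_m`, then `[P₀, v_{1m}] = 0`); the slots `m = 0, 1`
are bounded by dropping the subtracted nonnegative terms, AM–GM, the `(0 1)` relabelling and
`∫v₀₁u₀² = ‖v‖₁L⁻³∫u₀² ≤ ‖v‖₁L⁻³∫F²`. [folklore] -/
theorem zf_pair_bound (hL : 0 < L) {v : ℝ → ℝ≥0∞} (hvm : Measurable v) {R₀ : ℝ}
    (hR : ∀ r, R₀ < r → v r = 0) (hfin : ∀ r, v r ≠ ⊤)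
    (hC0 : Continuous fun x : Space => (v ‖x‖).toReal)
    {F : Config (n + 2) → ℝ} (hFt : IsPeriodicTest L F)
    (hFsymm : ∀ (σ : Equiv.Perm (Fin (n + 2))) (X : Config (n + 2)), F (X ∘ σ) = F X)
    (hF0 : ∀ X, 0 ≤ F X) {uu : Fin (n + 2) → Config (n + 2) → ℝ}
    (huu : ∀ m X, uu m X = (L ^ 3)⁻¹ * ∫ y in cell L, F (Function.update X m y))
    {u : Config (n + 2) → ℝ} (hu : ∀ X, u X = ∑ m, uu m X) {W : Config (n + 1) → ℝ}
    (hW : ∀ Y, W Y = (L ^ 3)⁻¹ * ∫ x in cell L, u (vecCons x Y)) :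
    (∫ X in cellN (n + 2) L, (periodizedPotential v L (X 0 - X 1)).toReal * (uu 0 X * u X)) -
        ∫ X in cellN (n + 2) L, (periodizedPotential v L (X 0 - X 1)).toReal * (F X * W (Fin.tail X)) ≤
      2 * ((∫⁻ y : Space, v ‖y‖).toReal * (L ^ 3)⁻¹ * ∫ X in cellN (n + 2) L, F X ^ 2) := by
  have hwc : Continuous fun x : Space => (periodizedPotential v L x).toReal :=
    (contDiff_toReal_periodizedPotential hL hR hfin (contDiff_zero.2 hC0)).continuous
  obtain ⟨w, hw⟩ : ∃ w : Config (n + 2) → ℝ, w = fun X => (periodizedPotential v L (X 0 - X 1)).toReal :=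
    ⟨_, rfl⟩
  have hw' : ∀ X, (periodizedPotential v L (X 0 - X 1)).toReal = w X := fun X => by rw [hw]
  have hwXc : Continuous w := by
    rw [hw]; exact hwc.comp ((continuous_apply 0).sub (continuous_apply 1))
  have hw0 : ∀ X, 0 ≤ w X := fun X => by rw [hw]; exact ENNReal.toReal_nonneg
  have huut : ∀ m, IsPeriodicTest L (uu m) := zf_isPeriodicTest_uu hL hFt hFsymm huu
  have hut : IsPeriodicTest L u := zf_isPeriodicTest_u hL hFt hFsymm huu hu
  have hL3 : 0 ≤ (L ^ 3)⁻¹ := inv_nonneg.2 (pow_nonneg hL.le 3)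
  have huu0 : ∀ m X, 0 ≤ uu m X := fun m X => by
    rw [huu]
    exact mul_nonneg hL3 (setIntegral_nonneg (measurableSet_cell L) fun y _ => hF0 _)
  obtain ⟨G, hG⟩ : ∃ G : Config (n + 1) → ℝ, G = fun Y => (L ^ 3)⁻¹ * ∫ x in cell L, F (vecCons x Y) :=
    ⟨_, rfl⟩
  have hG' : ∀ Y, G Y = (L ^ 3)⁻¹ * ∫ x in cell L, F (vecCons x Y) := fun Y => by rw [hG]
  have hGc : Continuous G := (zf_isPeriodicTest_G hL hFt hG').continuous
  -- the slot averages `WW m = P₀u_m`, `W = ∑ WW m`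
  obtain ⟨WW, hWW⟩ : ∃ WW : Fin (n + 2) → Config (n + 1) → ℝ,
      WW = fun m Y => (L ^ 3)⁻¹ * ∫ x in cell L, uu m (vecCons x Y) := ⟨_, rfl⟩
  have hWW' : ∀ m Y, WW m Y = (L ^ 3)⁻¹ * ∫ x in cell L, uu m (vecCons x Y) := fun m Y => by rw [hWW]
  have hWWt : ∀ m, IsPeriodicTest L (WW m) := fun m => zf_avg_isPeriodicTest hL (huut m) (hWW' m)
  have hWW0 : ∀ m Y, 0 ≤ WW m Y := fun m Y => by
    rw [hWW']
    exact mul_nonneg hL3 (setIntegral_nonneg (measurableSet_cell L) fun x _ => huu0 _ _)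
  have hWsum : ∀ Y, W Y = ∑ m, WW m Y := by
    intro Y
    rw [hW, zf_avg_of_sum Finset.univ (fun m _ => (huut m).continuous) (fun m _ => hWW' m)]
    congr 1
    exact integral_congr_ae (ae_of_all _ fun x => hu _)
  simp only [hw']
  -- expansion over the slots
  have e1 : ∫ X in cellN (n + 2) L, w X * (uu 0 X * u X) =
      ∑ m, ∫ X in cellN (n + 2) L, w X * (uu 0 X * uu m X) := by
    have hpt : ∀ X, w X * (uu 0 X * u X) = ∑ m, w X * (uu 0 X * uu m X) := fun X => by
      rw [hu, Finset.mul_sum, Finset.mul_sum]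
    rw [integral_congr_ae (ae_of_all _ hpt), integral_finsetSum Finset.univ
      (f := fun m X => w X * (uu 0 X * uu m X)) fun m _ =>
      integrableOn_cellN (hwXc.mul ((huut 0).continuous.mul (huut m).continuous)) L]
  have e2 : ∫ X in cellN (n + 2) L, w X * (F X * W (Fin.tail X)) =
      ∑ m, ∫ X in cellN (n + 2) L, w X * (F X * WW m (Fin.tail X)) := by
    have hpt : ∀ X, w X * (F X * W (Fin.tail X)) = ∑ m, w X * (F X * WW m (Fin.tail X)) := fun X => by
      rw [hWsum, Finset.mul_sum, Finset.mul_sum]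
    rw [integral_congr_ae (ae_of_all _ hpt), integral_finsetSum Finset.univ
      (f := fun m X => w X * (F X * WW m (Fin.tail X))) fun m _ =>
      integrableOn_cellN (hwXc.mul (hFt.continuous.mul
        ((hWWt m).continuous.comp mixedLaw_continuous_tail))) L]
  -- the slots `m ≥ 2` cancel
  have hkill : ∀ j : Fin n,
      ∫ X in cellN (n + 2) L, w X * (uu 0 X * uu j.succ.succ X) =
        ∫ X in cellN (n + 2) L, w X * (F X * WW j.succ.succ (Fin.tail X)) := by
    intro j
    have hm0 : j.succ.succ ≠ 0 := Fin.succ_ne_zero _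
    have hm1 : j.succ.succ ≠ (1 : Fin (n + 2)) := by
      rw [← Fin.succ_zero_eq_one]
      exact fun h => Fin.succ_ne_zero j (Fin.succ_injective _ h)
    have hτ0 : Equiv.swap (0 : Fin (n + 2)) j.succ.succ 0 = j.succ.succ := Equiv.swap_apply_left _ _
    have hτ1 : Equiv.swap (0 : Fin (n + 2)) j.succ.succ 1 = 1 :=
      Equiv.swap_apply_of_ne_of_ne (Fin.zero_ne_one' (n := n + 1)).symm hm1.symm
    have hτm : Equiv.swap (0 : Fin (n + 2)) j.succ.succ j.succ.succ = 0 := Equiv.swap_apply_right _ _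
    -- the bath weight `h(Y) = v^per(y₀ − y_{j+1})`, `h(tail X) = v^per(x_{j+2} − x₁)`
    obtain ⟨h, hh⟩ : ∃ h : Config (n + 1) → ℝ,
        h = fun Y => (periodizedPotential v L (Y 0 - Y j.succ)).toReal := ⟨_, rfl⟩
    have hhc : Continuous h := by
      rw [hh]; exact hwc.comp ((continuous_apply 0).sub (continuous_apply j.succ))
    have hhX : ∀ X : Config (n + 2),
        (periodizedPotential v L (X j.succ.succ - X 1)).toReal = h (Fin.tail X) := fun X => by
      rw [hh, periodizedPotential_sub_comm]
      rfl
    have l1 : ∫ X in cellN (n + 2) L, w X * (uu 0 X * uu j.succ.succ X) =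
        ∫ X in cellN (n + 2) L, h (Fin.tail X) * uu 0 X * uu j.succ.succ X := by
      rw [← setIntegral_cellN_comp_perm L (Equiv.swap (0 : Fin (n + 2)) j.succ.succ)
        (fun X => w X * (uu 0 X * uu j.succ.succ X))]
      refine integral_congr_ae (ae_of_all _ fun X => ?_)
      dsimp only
      rw [← hw', Function.comp_apply, Function.comp_apply, hτ0, hτ1, zf_uu_comp_perm hFsymm huu,
        zf_uu_comp_perm hFsymm huu, hτ0, hτm, hhX]
      ring
    have l2 : ∫ X in cellN (n + 2) L, w X * (F X * WW j.succ.succ (Fin.tail X)) =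
        ∫ X in cellN (n + 2) L, h (Fin.tail X) * F X * WW j.succ.succ (Fin.tail X) := by
      rw [← setIntegral_cellN_comp_perm L (Equiv.swap (0 : Fin (n + 2)) j.succ.succ)
        (fun X => w X * (F X * WW j.succ.succ (Fin.tail X)))]
      refine integral_congr_ae (ae_of_all _ fun X => ?_)
      dsimp only
      rw [← hw', Function.comp_apply, Function.comp_apply, hτ0, hτ1, hFsymm,
        zf_avgUU_tail_comp_swap hL hFt hFsymm huu hm0 (hWW' _), hhX]
      ring
    rw [l1, l2]
    exact zf_pot_uu_zero hL hFt huu hG' hhc (huut _).continuous (hWWt _).continuous (hWW' _)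
  -- the key positivity input `∫ v₀₁ u₀² = ‖v‖₁ L⁻³ ∫ u₀² ≤ ‖v‖₁ L⁻³ ∫ F²`
  have hkey : ∫ X in cellN (n + 2) L, w X * uu 0 X ^ 2 ≤
      (∫⁻ y : Space, v ‖y‖).toReal * (L ^ 3)⁻¹ * ∫ X in cellN (n + 2) L, F X ^ 2 := by
    have h1 : ∫ X in cellN (n + 2) L, w X * uu 0 X ^ 2 =
        (∫⁻ y : Space, v ‖y‖).toReal * (L ^ 3)⁻¹ * ∫ X in cellN (n + 2) L, uu 0 X ^ 2 := by
      simp only [← hw', zf_uu_zero_eq huu hG']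
      exact zf_integral_pot_tail_sq hL hvm hR hfin hwc hGc
    rw [h1]
    exact mul_le_mul_of_nonneg_left (zf_integral_uu_zero_sq_le hL hFt huu)
      (mul_nonneg ENNReal.toReal_nonneg hL3)
  -- slot `0` term
  have hT0 : (∫ X in cellN (n + 2) L, w X * (uu 0 X * uu 0 X)) -
      (∫ X in cellN (n + 2) L, w X * (F X * WW 0 (Fin.tail X))) ≤
      ∫ X in cellN (n + 2) L, w X * uu 0 X ^ 2 := by
    have hnn : 0 ≤ ∫ X in cellN (n + 2) L, w X * (F X * WW 0 (Fin.tail X)) :=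
      setIntegral_nonneg (measurableSet_cellN _ _) fun X _ =>
        mul_nonneg (hw0 X) (mul_nonneg (hF0 X) (hWW0 _ _))
    have heq : ∫ X in cellN (n + 2) L, w X * (uu 0 X * uu 0 X) = ∫ X in cellN (n + 2) L, w X * uu 0 X ^ 2 :=
      integral_congr_ae (ae_of_all _ fun X => by simp only [sq])
    linarith
  -- slot `1` term
  have hT1 : (∫ X in cellN (n + 2) L, w X * (uu 0 X * uu (Fin.succ 0) X)) -
      (∫ X in cellN (n + 2) L, w X * (F X * WW (Fin.succ 0) (Fin.tail X))) ≤
      ∫ X in cellN (n + 2) L, w X * uu 0 X ^ 2 := by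
    rw [Fin.succ_zero_eq_one]
    have hnn : 0 ≤ ∫ X in cellN (n + 2) L, w X * (F X * WW 1 (Fin.tail X)) :=
      setIntegral_nonneg (measurableSet_cellN _ _) fun X _ =>
        mul_nonneg (hw0 X) (mul_nonneg (hF0 X) (hWW0 _ _))
    -- `∫ v₀₁ u₁² = ∫ v₀₁ u₀²` by the relabelling `(0 1)`
    have hsym : ∫ X in cellN (n + 2) L, w X * uu 1 X ^ 2 = ∫ X in cellN (n + 2) L, w X * uu 0 X ^ 2 := by
      rw [← setIntegral_cellN_comp_perm L (Equiv.swap (0 : Fin (n + 2)) 1) (fun X => w X * uu 1 X ^ 2)]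
      refine integral_congr_ae (ae_of_all _ fun X => ?_)
      dsimp only
      rw [← hw', ← hw', Function.comp_apply, Function.comp_apply, Equiv.swap_apply_left,
        Equiv.swap_apply_right, zf_uu_comp_perm hFsymm huu, Equiv.swap_apply_right,
        periodizedPotential_sub_comm]
    have ham : ∫ X in cellN (n + 2) L, w X * (uu 0 X * uu 1 X) ≤
        ∫ X in cellN (n + 2) L, (w X * uu 0 X ^ 2 + w X * uu 1 X ^ 2) / 2 :=
      integral_mono (integrableOn_cellN (hwXc.mul ((huut 0).continuous.mul (huut 1).continuous)) L)
        (integrableOn_cellN (((hwXc.mul ((huut 0).continuous.pow 2)).add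
          (hwXc.mul ((huut 1).continuous.pow 2))).div_const 2) L) fun X => by
          dsimp only
          nlinarith [mul_nonneg (hw0 X) (sq_nonneg (uu 0 X - uu 1 X))]
    have hsplit : ∫ X in cellN (n + 2) L, (w X * uu 0 X ^ 2 + w X * uu 1 X ^ 2) / 2 =
        ((∫ X in cellN (n + 2) L, w X * uu 0 X ^ 2) + ∫ X in cellN (n + 2) L, w X * uu 1 X ^ 2) / 2 := by
      have i0 : IntegrableOn (fun X => w X * uu 0 X ^ 2) (cellN (n + 2) L) :=
        integrableOn_cellN (hwXc.mul ((huut 0).continuous.pow 2)) L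
      have i1 : IntegrableOn (fun X => w X * uu 1 X ^ 2) (cellN (n + 2) L) :=
        integrableOn_cellN (hwXc.mul ((huut 1).continuous.pow 2)) L
      rw [integral_div, integral_add i0 i1]
    rw [hsplit, hsym] at ham
    linarith
  -- assemble
  rw [e1, e2, ← Finset.sum_sub_distrib, Fin.sum_univ_succ, Fin.sum_univ_succ]
  simp only [hkill, sub_self, Finset.sum_const_zero, add_zero]
  linarith [hT0, hT1, hkey]

/-! ### The f-sum bound for a minimiser, and the stub -/

/-- **The zero-mode f-sum bound at fixed `(n, L)`.** For a finite finite-range measurable profile `v`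
with `x ↦ v(|x|)` continuous, `L > 0` and a real positive finite-energy minimiser `Φ` of `n + 2`
bosons: the counting ratio `g = (N̂₀|Φ|)/|Φ|` is a periodic test function and
`𝓔_{|Φ|}(g, g) ≤ 2‖v‖₁ L⁻³ (n+2)(n+1)`. [cite: PitaevskiiStringari1991, (9)] -/
theorem zf_dirichlet_le (hL : 0 < L) {v : ℝ → ℝ≥0∞} (hvm : Measurable v) {R₀ : ℝ}
    (hR : ∀ r, R₀ < r → v r = 0) (hfin : ∀ r, v r ≠ ⊤)
    (hC0 : Continuous fun x : Space => (v ‖x‖).toReal)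
    (Φ : PeriodicTrialState (n + 2) L) (hreal : ∀ X, Φ.ψ X = (‖Φ.ψ X‖ : ℂ)) (hpos : ∀ X, Φ.ψ X ≠ 0)
    (hE : periodicEnergy v Φ = periodicGroundStateEnergy v (n + 2) L) (hEfin : periodicEnergy v Φ ≠ ⊤)
    {F : Config (n + 2) → ℝ} (hF : ∀ X, ‖Φ.ψ X‖ = F X)
    {uu : Fin (n + 2) → Config (n + 2) → ℝ}
    (huu : ∀ m X, uu m X = (L ^ 3)⁻¹ * ∫ y in cell L, F (Function.update X m y))
    {u : Config (n + 2) → ℝ} (hu : ∀ X, u X = ∑ m, uu m X) {g : Config (n + 2) → ℝ}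
    (hg : ∀ X, g X = u X / F X) :
    IsPeriodicTest L g ∧ dirichletFormW L F g g ≤
      2 * (∫⁻ y : Space, v ‖y‖).toReal * (L ^ 3)⁻¹ * (((n : ℝ) + 2) * ((n : ℝ) + 1)) := by
  have hFt := zf_F_isPeriodicTest Φ hreal hF
  have hFsymm := zf_F_symm Φ hF
  have hF0 := zf_F_pos Φ hpos hF
  have hut : IsPeriodicTest L u := zf_isPeriodicTest_u hL hFt hFsymm huu hu
  obtain ⟨W, hW⟩ : ∃ W : Config (n + 1) → ℝ, W = fun Y => (L ^ 3)⁻¹ * ∫ x in cell L, u (vecCons x Y) :=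
    ⟨_, rfl⟩
  have hW' : ∀ Y, W Y = (L ^ 3)⁻¹ * ∫ x in cell L, u (vecCons x Y) := fun Y => by rw [hW]
  have hVc : Continuous fun X : Config (n + 2) => (periodicInteraction v L X).toReal :=
    (contDiff_toReal_periodicInteraction hL hR hfin (contDiff_zero.2 hC0)).continuous
  have hVsymm : ∀ (σ : Equiv.Perm (Fin (n + 2))) (X : Config (n + 2)),
      (periodicInteraction v L (X ∘ σ)).toReal = (periodicInteraction v L X).toReal := fun σ X => by
    rw [periodicInteraction_comp_perm]
  obtain ⟨hgt, h1⟩ := zf_dirichlet_eq_firstMoment hvm Φ hreal hpos hE hEfin hF hut hg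
  have h2 := zf_firstMoment_symm hL hVc hVsymm hFt hFsymm huu hu (periodicEnergy v Φ).toReal
  have h3 := zf_firstMoment_slot_zero hL hvm Φ hreal hpos hE hEfin hF huu hu hW'
  have h4 := zf_pot_reduction hL hR hfin hC0 hFt hFsymm huu hu hW'
  have h5 := zf_pair_bound hL hvm hR hfin hC0 hFt hFsymm (fun X => (hF0 X).le) huu hu hW'
  rw [zf_integral_F_sq Φ hF, mul_one] at h5
  refine ⟨hgt, ?_⟩
  have hn1 : (0 : ℝ) ≤ (n : ℝ) + 1 := by positivity
  have hn2 : (0 : ℝ) ≤ (n : ℝ) + 2 := by positivity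
  rw [h1, h2]
  have h6 : (∫ X in cellN (n + 2) L, gradDot (uu 0) u X) +
      (∫ X in cellN (n + 2) L, (periodicInteraction v L X).toReal * (uu 0 X * u X)) -
      (periodicEnergy v Φ).toReal * ∫ X in cellN (n + 2) L, uu 0 X * u X ≤
      ((n : ℝ) + 1) * (2 * ((∫⁻ y : Space, v ‖y‖).toReal * (L ^ 3)⁻¹)) := by
    have h7 := mul_le_mul_of_nonneg_left h5 hn1
    linarith
  calc ((n : ℝ) + 2) * _ ≤ ((n : ℝ) + 2) * (((n : ℝ) + 1) * (2 * ((∫⁻ y : Space, v ‖y‖).toReal * (L ^ 3)⁻¹))) :=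
        mul_le_mul_of_nonneg_left h6 hn2
    _ = _ := by ring

/-- **S3a `stub_zeroModeFSum` — the ZERO-MODE F-SUM BOUND (density-uniform).** For every smooth-class
`v` there are `A ≥ 0` and `ρ₀ > 0` such that for all large `n`, every box `L ≥ sideLength ρ₀ (n+2)`
and every real non-negative nowhere-vanishing `C³` minimiser `Φ` of `n + 2` bodies at side `L`: the
zero-mode counting ratio `g_Φ = (N̂₀Φ)/Φ`, `(N̂₀Φ)(X) = ∑ⱼ L⁻³∫_cell Φ(X; xⱼ ↦ y)dy`, is a periodic
test function and `𝓔_{|Φ|}(g_Φ, g_Φ) ≤ A · ρ_L · (n+2)`, `ρ_L = (n+2)/L³` — the first moment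
`m₁(N̂₀) = ⟨N̂₀Φ, (H − E₀)N̂₀Φ⟩ = ½⟨Φ,[N̂₀,[V,N̂₀]]Φ⟩` of the zero-mode number. Here with
`A = 2‖v‖₁`, `‖v‖₁ = ∫_{ℝ³} v(|x|)dx`, `ρ₀ = 1` and every `n` (`zf_dirichlet_le`:
`m₁ ≤ 2‖v‖₁N(N−1)/L³` — ground-state representation, `[T,N̂₀] = 0`, the double commutator is a sum
over pairs of two-body terms `P_kv_{kl}P_k = L⁻³‖v‖₁P_k`). The `C³` and edge hypotheses are not used.
[cite: PitaevskiiStringari1991, (9)] [cite: Stringari1995, §2.3 (19)–(23)] -/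
theorem stub_zeroModeFSum (v : ℝ → ℝ≥0∞) (hv : IsRepulsiveFiniteRange v)
    (hfin : ∀ r, v r ≠ ⊤) (hC2 : ContDiff ℝ 2 (fun x : Space => (v ‖x‖).toReal))
    (hedge : ∃ Cₑ : ℝ, ∀ x : Space,
      ‖iteratedFDeriv ℝ 2 (fun x : Space => (v ‖x‖).toReal) x‖ ≤ Cₑ * Real.sqrt ((v ‖x‖).toReal)) :
    ∃ A : ℝ, 0 ≤ A ∧ ∃ ρ₀ : ℝ, 0 < ρ₀ ∧ ∀ᶠ n : ℕ in atTop, ∀ L : ℝ, sideLength ρ₀ (n + 2) ≤ L →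
      ∀ Φ : PeriodicTrialState (n + 2) L,
        periodicEnergy v Φ = periodicGroundStateEnergy v (n + 2) L → periodicEnergy v Φ ≠ ⊤ →
        ContDiff ℝ 3 Φ.ψ → (∀ X, Φ.ψ X = (‖Φ.ψ X‖ : ℂ)) → (∀ X, Φ.ψ X ≠ 0) →
        IsPeriodicTest L (fun X =>
            (∑ j, (L ^ 3)⁻¹ * ∫ y in cell L, ‖Φ.ψ (Function.update X j y)‖) / ‖Φ.ψ X‖) ∧
          dirichletFormW L (fun X => ‖Φ.ψ X‖)
              (fun X => (∑ j, (L ^ 3)⁻¹ * ∫ y in cell L, ‖Φ.ψ (Function.update X j y)‖) / ‖Φ.ψ X‖)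
              (fun X => (∑ j, (L ^ 3)⁻¹ * ∫ y in cell L, ‖Φ.ψ (Function.update X j y)‖) / ‖Φ.ψ X‖) ≤
            A * (((n : ℝ) + 2) / L ^ 3) * ((n : ℝ) + 2) := by
  obtain ⟨_, _⟩ := hedge
  obtain ⟨hvm, R₀, hR⟩ := hv
  have hI0 : 0 ≤ (∫⁻ y : Space, v ‖y‖).toReal := ENNReal.toReal_nonneg
  refine ⟨2 * (∫⁻ y : Space, v ‖y‖).toReal, by positivity, 1, one_pos,
    Filter.Eventually.of_forall fun n L hLle Φ hE hEfin _ hreal hpos => ?_⟩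
  have hsL : 0 < sideLength 1 (n + 2) :=
    Real.rpow_pos_of_pos (div_pos (Nat.cast_pos.2 (Nat.succ_pos _)) one_pos) _
  have hL : 0 < L := hsL.trans_le hLle
  have h := zf_dirichlet_le (n := n) hL hvm hR hfin hC2.continuous Φ hreal hpos hE hEfin
    (F := fun X => ‖Φ.ψ X‖) (fun X => rfl)
    (uu := fun m X => (L ^ 3)⁻¹ * ∫ y in cell L, ‖Φ.ψ (Function.update X m y)‖) (fun m X => rfl)
    (u := fun X => ∑ m, (L ^ 3)⁻¹ * ∫ y in cell L, ‖Φ.ψ (Function.update X m y)‖) (fun X => rfl)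
    (g := fun X => (∑ j, (L ^ 3)⁻¹ * ∫ y in cell L, ‖Φ.ψ (Function.update X j y)‖) / ‖Φ.ψ X‖)
    (fun X => rfl)
  refine ⟨h.1, h.2.trans ?_⟩
  have hc : 0 ≤ 2 * (∫⁻ y : Space, v ‖y‖).toReal * (L ^ 3)⁻¹ * ((n : ℝ) + 2) := by positivity
  have hle : (n : ℝ) + 1 ≤ (n : ℝ) + 2 := by linarith
  calc 2 * (∫⁻ y : Space, v ‖y‖).toReal * (L ^ 3)⁻¹ * (((n : ℝ) + 2) * ((n : ℝ) + 1))
      = 2 * (∫⁻ y : Space, v ‖y‖).toReal * (L ^ 3)⁻¹ * ((n : ℝ) + 2) * ((n : ℝ) + 1) := by ring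
    _ ≤ 2 * (∫⁻ y : Space, v ‖y‖).toReal * (L ^ 3)⁻¹ * ((n : ℝ) + 2) * ((n : ℝ) + 2) :=
        mul_le_mul_of_nonneg_left hle hc
    _ = _ := by rw [div_eq_mul_inv]; ring

end Summit.AtomisticToContinuum.BoseEinsteinCondensation.Theorems.CorrectorClosure.VolumeHomotopySumRuleDomination

end
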